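import Literature.Probability.LatticeModels.TorusRowPairDecay
import Literature.Probability.LatticeModels.MessagerMiracleSoleFree
import Literature.Probability.LatticeModels.SharpnessSubcritical
import Literature.Probability.LatticeModels.PlanarIsingCriticalMagnetization
import HarnessLib

/-!
# The planar Ising two-point function below Onsager's correlation length with constant one:
# `⟨σ₀σ_x⟩^∅_β ≤ (e^{2β} tanh β)^{‖x‖_∞}` for every `x ∈ ℤ²` and every `0 < β < β_c(2)`

Topic `Literature/Probability/LatticeModels`, namespace `Literature.Probability.LatticeModels`.

For the nearest-neighbour Ising model on `ℤ²` at `0 < β < β_c(2) = ½ log(1+√2)`, Onsager's parameter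
`γ₂(β) = e^{-2β}/tanh β > 1` (`onsagerGammaTwo`; Deift–Its–Krasovsky 2013, §2, eq. (22)) is the exponential of the
inverse correlation length along a lattice axis, `1/ξ(β) = log γ₂ = log coth β − 2β` (T. T. Wu, Phys. Rev. 149 (1966)
380, `T > T_c`; McCoy–Wu, *The two-dimensional Ising model*, Ch. XI–XII). This file proves the GLOBAL bound with
that exact rate and constant ONE,

  `⟨σ₀σ_x⟩^∅_β ≤ γ₂(β)^{−‖x‖_∞} = (e^{2β} tanh β)^{‖x‖_∞}`  for all `x ∈ ℤ²`, `0 < β < β_c(2)`,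

from four ingredients, all theorems of the tree:

1. **Wu's decay at every radius** (§1, `exists_norm_toeplitzDet_onsagerSymbol_le_pow`): for every `1 < R < γ₂(β)`
   there is `K` with `|D_n(φ_β)| ≤ K R^{−n}` for all `n` — the landed Hadamard/triangular-multiplier proof of
   `toeplitzDet_onsagerSymbol_exp_decay_holds` (`OnsagerToeplitzDecay.lean`, radius fixed there at `2/(1+γ₂⁻¹)`)
   re-run with the radius a parameter (the symbol's Wiener–Hopf factors are analytic on `|z| < γ₂`, since
   `γ₁γ₂ = e^{−4β} < 1`).
2. **GKS-II supermultiplicativity** of the free two-point function (§2, `twoPointFree_mul_le_add`, any `d`):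
   `⟨σ₀σ_a⟩^∅ ⟨σ₀σ_b⟩^∅ ≤ ⟨σ₀σ_{a+b}⟩^∅` (Griffiths' second inequality in a box, translation covariance,
   box limits; Friedli–Velenik 2017, Thm. 3.20, Exercise 3.12, Exercise 3.16) — hence `(⟨σ₀σ_x⟩^∅)^n ≤ ⟨σ₀σ_{nx}⟩^∅`.
3. **The axis bound with constant one** (§3, `twoPointFree_axis_le_inv_onsagerGammaTwo_pow`): the GKS sandwich
   `⟨σ₀σ_{ke₁}⟩^∅ ≤ (σσ)_p(β)(k) = Re D_k(φ_β) ≤ |D_k|` (`torusRowPairLimit_sandwich_at`, Montroll–Potts–Ward /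
   `torusRowPair_tendsto_toeplitzDet_holds`) gives `(⟨σ₀σ_{ke₁}⟩^∅)^n ≤ K R^{−nk}` for every `n`, so
   `⟨σ₀σ_{ke₁}⟩^∅ ≤ R^{−k}` for every `R < γ₂` (n-th roots), so `≤ γ₂^{−k}`: the constant is gone.
4. **Messager–Miracle-Solé** (§4, `twoPointFree_two_le_inv_onsagerGammaTwo_pow_supNorm`): `⟨σ₀σ_x⟩^∅ ≤ ⟨σ₀σ_{‖x‖_∞ e₁}⟩^∅`
   (`twoPointFree_le_axis_of_mem_sphere'`, Duminil-Copin 2019, eq. (4.10)), whence the sup-norm form; §4 also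
   records `γ₂⁻¹ = e^{2β} tanh β = E(E−1)/(E+1)` with `E = e^{2β}` and the monotonicity of `γ₂⁻¹` in `β`
   (for rational enclosures downstream).

Cell use (`pub/hubbard-tc`, MO-S3, seat p2, 2D → 3D ordering lemmas): summed over `ℤ²` the bound is the CLOSED-FORM
susceptibility ceiling `χ^{Is}(β) ≤ 1 + 8q/(1−q)²`, `q = e^{2β} tanh β`, for every `β < β_c(2)`; through Aizenman–Simon
and Lieb–Rivasseau it gives the layered plane rotator a closed-form weak-interlayer window up to the
Aizenman–Simon–Onsager point (sibling file `LayeredPlaneRotatorOnsagerLengthWindow.lean`).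

Presearch (p2 g24, 2026-08-28): the ingredients are classical in print (Friedli–Velenik 2017 p. 181, direction-dependent
`ξ`; Wu 1966 / Deift–Its–Krasovsky 2013 §5; Messager–Miracle-Solé 1977; Griffiths 1967); the assembled constant-one
sup-norm inequality with Onsager's `ξ` was not found as a stated theorem (corpus hybrid + vector search, galaxy).

## What this is not

Not the sharp asymptotics `⟨σ₀₀σ₀ₙ⟩ ≃ c(β) n^{-1/2} γ₂^{-n}` (Wu 1966) nor the Ornstein–Zernike / direction-dependent
correlation length off the axes (the sup-norm rate `log γ₂` is sharp on the axes only); nothing at or below `T_c`;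
no statement about `β_c(d)` for `d ≠ 2` and no use of `criticalBeta 2 = criticalBetaTwo` (the window is stated with
the explicit `criticalBetaTwo = ½ log(1+√2)`).
-/

noncomputable section

namespace Literature.Probability.LatticeModels

/-! ## §1 Wu's decay of `D_n(φ_β)` at every radius `R < γ₂(β)` -/

section Wu

open Filter Complex MeasureTheory intervalIntegral Finset
open scoped Topology
open Literature.Analysis.Toeplitz

/-- **Wu's bound at every radius below `γ₂`**: for `0 < β < β_c(2)` and every `1 < R < γ₂(β)` there is `K` with
`|D_n(φ_β)| ≤ K · R^{−n}` for all `n` — the proof of `toeplitzDet_onsagerSymbol_exp_decay_holds` (triangular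
Toeplitz multipliers built from the Wiener–Hopf factors `h(z) = (1−γ₁z)^{1/2}(1−z/γ₂)^{1/2}`, `g = 1/h`, analytic on
`|z| ≤ R` because `γ₁R < γ₁γ₂ = e^{−4β} < 1` and `R/γ₂ < 1`; Hadamard's column bound) with the radius left free.
The optimal rate `log γ₂ = log coth β − 2β` is Onsager's inverse correlation length (Wu 1966, `T > T_c`).
[cite: Wu1966, T > T_c asymptotics of D_n(φ_Onsager) (= DeiftItsKrasovsky2013 §5 eq. (64))] -/
theorem exists_norm_toeplitzDet_onsagerSymbol_le_pow {β : ℝ} (hβ0 : 0 < β) (hβc : β < criticalBetaTwo)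
    {R : ℝ} (hR1 : 1 < R) (hR2 : R < onsagerGammaTwo β) :
    ∃ K : ℝ, ∀ n : ℕ, ‖toeplitzDet (circleCoeff (onsagerSymbol β)) n‖ ≤ K * R⁻¹ ^ n := by
  have hγ₁0 := onsagerGammaOne_pos hβ0
  have hγ₂1 : 1 < onsagerGammaTwo β := (one_lt_onsagerGammaTwo_iff hβ0).2 hβc
  have hγ₂0 : 0 < onsagerGammaTwo β := one_pos.trans hγ₂1
  set γ₁ := onsagerGammaOne β with hγ₁
  set γ₂ := onsagerGammaTwo β with hγ₂
  have hi0 : 0 < γ₂⁻¹ := inv_pos.2 hγ₂0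
  have hR0 : 0 < R := one_pos.trans hR1
  -- smallness of the two bases on the closed disc of radius `R`
  have hRa1 : γ₁ * R < 1 := by
    have h4 : Real.exp (-4 * β) < 1 := Real.exp_lt_one_iff.2 (by linarith)
    calc γ₁ * R < γ₁ * γ₂ := mul_lt_mul_of_pos_left hR2 hγ₁0
      _ = Real.exp (-4 * β) := onsagerGammaOne_mul_onsagerGammaTwo hβ0
      _ < 1 := h4
  have hRa2 : γ₂⁻¹ * R < 1 := by rwa [inv_mul_lt_iff₀ hγ₂0, mul_one]
  -- the bases stay in the slit plane on the closed disc of radius `R`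
  have hb1 : ∀ z ∈ Metric.closedBall (0 : ℂ) R, (1 - (γ₁ : ℂ) * z) ∈ Complex.slitPlane :=
    fun z hz => Complex.mem_slitPlane_iff.2 (Or.inl (re_one_sub_mul_pos_of_norm_le hγ₁0.le
      le_rfl hRa1 (mem_closedBall_zero_iff.1 hz)))
  have hb2 : ∀ z ∈ Metric.closedBall (0 : ℂ) R, (1 - (γ₂ : ℂ)⁻¹ * z) ∈ Complex.slitPlane := by
    intro z hz
    have h := re_one_sub_mul_pos_of_norm_le hi0.le le_rfl hRa2 (mem_closedBall_zero_iff.1 hz)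
    push_cast at h
    exact Complex.mem_slitPlane_iff.2 (Or.inl h)
  -- `h` and `g`
  have hhd : DifferentiableOn ℂ (fun z : ℂ => (1 - (γ₁ : ℂ) * z) ^ (1 / 2 : ℂ) *
      (1 - (γ₂ : ℂ)⁻¹ * z) ^ (1 / 2 : ℂ)) (Metric.closedBall 0 R) :=
    (DifferentiableOn.cpow_const (by fun_prop) hb1).mul (DifferentiableOn.cpow_const (by fun_prop) hb2)
  have hgd : DifferentiableOn ℂ (fun z : ℂ => (1 - (γ₁ : ℂ) * z) ^ (-(1 / 2) : ℂ) *
      (1 - (γ₂ : ℂ)⁻¹ * z) ^ (-(1 / 2) : ℂ)) (Metric.closedBall 0 R) :=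
    (DifferentiableOn.cpow_const (by fun_prop) hb1).mul (DifferentiableOn.cpow_const (by fun_prop) hb2)
  obtain ⟨s, Cs, hs0, hsb, hssum⟩ := exists_hasSum_of_differentiableOn_closedBall hR1 hhd
  obtain ⟨p, Cp, hp0, hpb, hpsum⟩ := exists_hasSum_of_differentiableOn_closedBall hR1 hgd
  simp only [mul_zero, sub_zero, Complex.one_cpow, mul_one] at hs0 hp0
  -- `h g = 1` on the closed unit disc
  have hhg : ∀ z : ℂ, ‖z‖ ≤ 1 → (1 - (γ₁ : ℂ) * z) ^ (1 / 2 : ℂ) * (1 - (γ₂ : ℂ)⁻¹ * z) ^ (1 / 2 : ℂ) *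
      ((1 - (γ₁ : ℂ) * z) ^ (-(1 / 2) : ℂ) * (1 - (γ₂ : ℂ)⁻¹ * z) ^ (-(1 / 2) : ℂ)) = 1 := by
    intro z hz
    have hz' : z ∈ Metric.closedBall (0 : ℂ) R := mem_closedBall_zero_iff.2 (hz.trans hR1.le)
    have h1 : (1 - (γ₁ : ℂ) * z) ≠ 0 := Complex.slitPlane_ne_zero (hb1 z hz')
    have h2 : (1 - (γ₂ : ℂ)⁻¹ * z) ≠ 0 := Complex.slitPlane_ne_zero (hb2 z hz')
    have h1' : (1 - (γ₁ : ℂ) * z) ^ (1 / 2 : ℂ) ≠ 0 := by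
      rw [Ne, Complex.cpow_eq_zero_iff]; simp [h1]
    have h2' : (1 - (γ₂ : ℂ)⁻¹ * z) ^ (1 / 2 : ℂ) ≠ 0 := by
      rw [Ne, Complex.cpow_eq_zero_iff]; simp [h2]
    rw [Complex.cpow_neg, Complex.cpow_neg, mul_mul_mul_comm, mul_inv_cancel₀ h1',
      mul_inv_cancel₀ h2', one_mul]
  -- common constants
  set C := max Cs Cp with hC
  have hsC : ∀ x, ‖s x‖ ≤ C * R⁻¹ ^ x := fun x =>
    (hsb x).trans (mul_le_mul_of_nonneg_right (le_max_left _ _) (by positivity))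
  have hpC : ∀ y, ‖p y‖ ≤ C * R⁻¹ ^ y := fun y =>
    (hpb y).trans (mul_le_mul_of_nonneg_right (le_max_right _ _) (by positivity))
  have hσ0 : 0 < R⁻¹ := inv_pos.2 hR0
  have hσ1 : R⁻¹ < 1 := inv_lt_one_of_one_lt₀ hR1
  -- the series on the circle
  have hexp1 : ∀ θ : ℝ, ‖Complex.exp (θ * I)‖ ≤ 1 := fun θ => (Complex.norm_exp_ofReal_mul_I θ).le
  have hexp2 : ∀ θ : ℝ, ‖Complex.exp (-(θ * I))‖ ≤ 1 := fun θ => by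
    rw [show -((θ : ℂ) * I) = ((-θ : ℝ) : ℂ) * I by push_cast; ring]
    exact (Complex.norm_exp_ofReal_mul_I _).le
  have hSp : ∀ θ : ℝ, ∑' x, s x * Complex.exp ((x : ℂ) * θ * I) =
      (1 - (γ₁ : ℂ) * Complex.exp (θ * I)) ^ (1 / 2 : ℂ) *
        (1 - (γ₂ : ℂ)⁻¹ * Complex.exp (θ * I)) ^ (1 / 2 : ℂ) := by
    intro θ
    have h := (hssum _ (hexp1 θ)).tsum_eq
    simp_rw [← Complex.exp_nat_mul, ← mul_assoc] at h
    exact h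
  have hGp : ∀ θ : ℝ, ∑' y, p y * Complex.exp ((y : ℂ) * θ * I) =
      (1 - (γ₁ : ℂ) * Complex.exp (θ * I)) ^ (-(1 / 2) : ℂ) *
        (1 - (γ₂ : ℂ)⁻¹ * Complex.exp (θ * I)) ^ (-(1 / 2) : ℂ) := by
    intro θ
    have h := (hpsum _ (hexp1 θ)).tsum_eq
    simp_rw [← Complex.exp_nat_mul, ← mul_assoc] at h
    exact h
  have hGm : ∀ θ : ℝ, ∑' y, p y * Complex.exp (-((y : ℂ) * θ * I)) =
      (1 - (γ₁ : ℂ) * Complex.exp (-(θ * I))) ^ (-(1 / 2) : ℂ) *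
        (1 - (γ₂ : ℂ)⁻¹ * Complex.exp (-(θ * I))) ^ (-(1 / 2) : ℂ) := by
    intro θ
    have h := (hpsum _ (hexp2 θ)).tsum_eq
    simp_rw [← Complex.exp_nat_mul, mul_neg, ← mul_assoc] at h
    exact h
  -- apply the quantitative abstract theorem with `σ = R⁻¹`
  refine ⟨_, fun n => norm_toeplitzDet_le_of_factorization (continuous_onsagerSymbol hβ0 hβc.ne)
    (fun θ => (norm_onsagerSymbol hβ0 hβc.ne θ).le) hσ0 hσ1 hsC hpC hs0 hp0 (fun θ => ?_)
    (fun θ => ?_) n⟩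
  · rw [hSp, hGp]
    exact hhg _ (hexp1 θ)
  · rw [hSp, hGm]
    exact onsagerSymbol_eq_factorization hβ0 hβc θ

/-- **The free two-point function along the axis is below `|D_k(φ_β)|`**: for `0 < β < β_c(2)` and every `k`,
`⟨σ₀σ_{(k,0)}⟩^∅_β ≤ |D_k(φ_β)|` — the GKS sandwich `⟨σσ⟩^∅ ≤ (σσ)_p(β)` (BGJS (3.7), `torusRowPairLimit_sandwich_at`)
and the Toeplitz form of the exact solution `(σσ)_p(β)(k) = Re D_k(φ_β)` (Montroll–Potts–Ward;
`torusRowPairLimit_eq_toeplitzDet` on `torusRowPair_tendsto_toeplitzDet_holds`).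
[cite: BenettinGallavottiJonaLasinioStella1973, eq. (3.7)] [cite: DeiftItsKrasovsky2013, §4, eq. (50)] -/
theorem twoPointFree_axis_le_norm_toeplitzDet {β : ℝ} (hβ0 : 0 < β) (hβc : β < criticalBetaTwo) (k : ℕ) :
    twoPointFree 2 β ![(k : ℤ), 0] ≤ ‖toeplitzDet (circleCoeff (onsagerSymbol β)) k‖ := by
  have hout := tendsto_torusRowPair_outer_of_toeplitz torusRowPair_tendsto_toeplitzDet_holds hβ0 hβc.ne k
  have h1 := (torusRowPairLimit_sandwich_at hβ0.le hout).1
  have h2 : torusRowPairLimit β k = (toeplitzDet (circleCoeff (onsagerSymbol β)) k).re := by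
    rw [← torusRowPairLimit_eq_toeplitzDet torusRowPair_tendsto_toeplitzDet_holds hβ0 hβc.ne k,
      Complex.ofReal_re]
  rw [h2] at h1
  exact h1.trans (Complex.re_le_norm _)

end Wu

/-! ## §2 GKS-II supermultiplicativity of the free two-point function (any `d`) -/

section GKS

open Finset Filter Topology Literature.Probability.Percolation

variable {d : ℕ}

/-- `{x, y} ∆ {y, z} = {x, z}` for three distinct points. [folklore] -/
private theorem insert_pair_symmDiff_insert_pair {α : Type*} [DecidableEq α] {x y z : α}
    (hxy : x ≠ y) (hxz : x ≠ z) (hyz : y ≠ z) :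
    symmDiff ({x, y} : Finset α) {y, z} = {x, z} := by
  ext w
  simp only [Finset.mem_symmDiff, Finset.mem_insert, Finset.mem_singleton]
  constructor
  · rintro (⟨h1 | h1, h2⟩ | ⟨h1 | h1, h2⟩)
    · exact Or.inl h1
    · exact absurd (Or.inl h1) h2
    · exact absurd (Or.inr h1) h2
    · exact Or.inr h1
  · rintro (rfl | rfl)
    · exact Or.inl ⟨Or.inl rfl, fun h => h.elim hxy hxz⟩
    · exact Or.inr ⟨Or.inr rfl, fun h => h.elim (fun h' => hxz h'.symm) fun h' => hyz h'.symm⟩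

/-- **GKS-II supermultiplicativity of the free two-point function**: for the nearest-neighbour Ising model on `ℤ^d`
and `β ≥ 0`, `⟨σ₀σ_a⟩^∅_β · ⟨σ₀σ_b⟩^∅_β ≤ ⟨σ₀σ_{a+b}⟩^∅_β` for all `a, b` (in the box `Λ_L`:
`⟨σ₀σ_a⟩⟨σ_aσ_{a+b}⟩ ≤ ⟨σ₀σ_{a+b}⟩` is Griffiths' second inequality with `σ_{{0,a}}σ_{{a,a+b}} = σ_{{0,a+b}}`;
`⟨σ_aσ_{a+b}⟩_{Λ_L} ≥ ⟨σ₀σ_b⟩_{Λ_{L−‖a‖}}` by translation covariance and volume monotonicity; then `L → ∞`).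
This is the subadditivity behind the inverse correlation length (Friedli–Velenik 2017, p. 181).
[cite: FriedliVelenik2017, Thm. 3.20 (GKS II) with Exercise 3.12 and Exercise 3.16; p. 181 (correlation length)] -/
theorem twoPointFree_mul_le_add {β : ℝ} (hβ : 0 ≤ β) (a b : Site d) :
    twoPointFree d β a * twoPointFree d β b ≤ twoPointFree d β (a + b) := by
  classical
  have hlim : hasBoxLimit_isingCorr_free d := hasBoxLimit_isingCorr_free_holds
  have hmono : isingCorr_free_mono_volume (d := d) :=
    fun hβ' hh _ _ _ hA h12 => isingCorr_free_le_of_subset (zdGraph d) hβ' hh hA h12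
  have htr : isingTwoPoint_free_translate (d := d) := isingTwoPoint_free_translate_holds
  have hgks1 : ∀ {Λ A : Finset (Site d)} {β h : ℝ} {bc : BoundaryCondition (Site d)},
      gks_one (zdGraph d) (Λ := Λ) (A := A) (β := β) (h := h) (bc := bc) :=
    fun {_ _ _ _ _} => Literature.Probability.LatticeModels.GKSInequalities.gks_one_holds (zdGraph d)
  by_cases ha : a = 0
  · subst ha; rw [twoPointFree_zero' β, one_mul, zero_add]
  by_cases hb : b = 0
  · subst hb; rw [twoPointFree_zero' β, mul_one, add_zero]
  by_cases hab : a + b = 0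
  · rw [hab, twoPointFree_zero' β]
    exact mul_le_one₀ (twoPointFree_le_one' hβ a) (twoPointFree_nonneg' hβ b)
      (twoPointFree_le_one' hβ b)
  have haab : a ≠ a + b := fun h => hb (by simpa using h.symm)
  -- box limits
  have hta := tendsto_isingTwoPoint_free hlim hβ a
  have htb : Tendsto (fun L : ℕ => isingTwoPoint (zdGraph d) (box d (L - Site.supNorm a)) β 0
      .free 0 b) atTop (𝓝 (twoPointFree d β b)) :=
    (tendsto_isingTwoPoint_free hlim hβ b).comp (tendsto_sub_atTop_nat _)
  refine le_of_tendsto_of_tendsto (hta.mul htb) (tendsto_isingTwoPoint_free hlim hβ (a + b)) ?_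
  filter_upwards [eventually_ge_atTop (Site.supNorm a), eventually_mem_box a,
    eventually_mem_box (a + b), (tendsto_sub_atTop_nat (Site.supNorm a)).eventually
      (eventually_mem_box b)] with L hLa haL habL hbL
  have hsub : (box d (L - Site.supNorm a)).image (· + a) ⊆ box d L := by
    intro w hw
    obtain ⟨u, hu, rfl⟩ := Finset.mem_image.1 hw
    have hu' := mem_box_iff_supNorm_le.1 hu
    have htri := Site.supNorm_add_le u a
    exact mem_box_iff_supNorm_le.2 (by omega)
  -- translation: `⟨σ₀σ_b⟩_{Λ_{L-‖a‖}} ≤ ⟨σ_aσ_{a+b}⟩_{Λ_L}`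
  have h1 := isingTwoPoint_free_le_translate hmono htr hβ hsub (zero_mem_box d _) hbL
  have h0a : 0 ≤ isingTwoPoint (zdGraph d) (box d L) β 0 .free 0 a :=
    isingTwoPoint_free_nonneg hgks1 hβ (zero_mem_box d L) haL
  -- GKS II in the box `Λ_L`
  have h2 : isingTwoPoint (zdGraph d) (box d L) β 0 .free 0 a *
      isingTwoPoint (zdGraph d) (box d L) β 0 .free a (a + b) ≤
        isingTwoPoint (zdGraph d) (box d L) β 0 .free 0 (a + b) := by
    rw [isingTwoPoint_eq_isingCorr _ _ _ _ _ (Ne.symm ha), isingTwoPoint_eq_isingCorr _ _ _ _ _ haab,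
      isingTwoPoint_eq_isingCorr _ _ _ _ _ (Ne.symm hab),
      ← insert_pair_symmDiff_insert_pair (Ne.symm ha) (Ne.symm hab) haab]
    refine gks_two_all (zdGraph d) (box d L) {0, a} {a, a + b} β 0 .free hβ le_rfl (Or.inl rfl) ?_ ?_
    · intro w hw
      simp only [Finset.mem_insert, Finset.mem_singleton] at hw
      rcases hw with rfl | rfl
      · exact zero_mem_box d L
      · exact haL
    · intro w hw
      simp only [Finset.mem_insert, Finset.mem_singleton] at hw
      rcases hw with rfl | rfl
      · exact haL
      · exact habL
  calc isingTwoPoint (zdGraph d) (box d L) β 0 .free 0 a *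
        isingTwoPoint (zdGraph d) (box d (L - Site.supNorm a)) β 0 .free 0 b
      ≤ isingTwoPoint (zdGraph d) (box d L) β 0 .free 0 a *
        isingTwoPoint (zdGraph d) (box d L) β 0 .free a (a + b) := mul_le_mul_of_nonneg_left h1 h0a
    _ ≤ isingTwoPoint (zdGraph d) (box d L) β 0 .free 0 (a + b) := h2

/-- **Iterated supermultiplicativity**: `(⟨σ₀σ_x⟩^∅_β)^n ≤ ⟨σ₀σ_{nx}⟩^∅_β` for `β ≥ 0`, `n ∈ ℕ`.
[cite: FriedliVelenik2017, Thm. 3.20 with p. 181 (subadditivity of −log⟨σ₀σ_x⟩)] -/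
theorem pow_le_twoPointFree_nsmul {β : ℝ} (hβ : 0 ≤ β) (x : Site d) (n : ℕ) :
    twoPointFree d β x ^ n ≤ twoPointFree d β (n • x) := by
  induction n with
  | zero => rw [pow_zero, zero_nsmul, twoPointFree_zero' β]
  | succ n ih =>
      rw [pow_succ, succ_nsmul]
      exact (mul_le_mul_of_nonneg_right ih (twoPointFree_nonneg' hβ x)).trans
        (twoPointFree_mul_le_add hβ _ _)

end GKS

/-! ## §3 The axis bound with constant one: `⟨σ₀σ_{ke₁}⟩^∅_β ≤ γ₂(β)^{−k}` -/

section Axis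

open Filter Topology
open Literature.Analysis.Toeplitz

/-- n-th roots: if `0 ≤ t`, `0 < ρ` and `t^n ≤ K ρ^n` for every `n`, then `t ≤ ρ`. [folklore] -/
private theorem le_of_forall_pow_le_mul_pow {t ρ K : ℝ} (hρ : 0 < ρ)
    (h : ∀ n : ℕ, t ^ n ≤ K * ρ ^ n) : t ≤ ρ := by
  by_contra hlt
  push Not at hlt
  have h1 : 1 < t / ρ := (one_lt_div hρ).2 hlt
  obtain ⟨n, hn⟩ := ((tendsto_pow_atTop_atTop_of_one_lt h1).eventually_gt_atTop K).exists
  have h2 : (t / ρ) ^ n ≤ K := by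
    rw [div_pow, div_le_iff₀ (pow_pos hρ n)]
    exact h n
  linarith

/-- `n • (k, 0) = (nk, 0)` in `ℤ²`. [folklore] -/
private theorem nsmul_axis_two (n k : ℕ) :
    n • (![(k : ℤ), 0] : Site 2) = ![((n * k : ℕ) : ℤ), 0] := by
  ext i
  fin_cases i <;> simp

/-- **The axis two-point function below Onsager's correlation length, constant one**: for the nearest-neighbour
Ising model on `ℤ²`, `0 < β < β_c(2)` and every `k ∈ ℕ`,

  `⟨σ₀σ_{(k,0)}⟩^∅_β ≤ γ₂(β)^{−k}`,  `γ₂(β) = e^{−2β}/tanh β = exp(1/ξ(β))`.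

(For `1 < R < γ₂`: `(⟨σ₀σ_{ke₁}⟩^∅)^n ≤ ⟨σ₀σ_{nke₁}⟩^∅ ≤ |D_{nk}(φ_β)| ≤ K R^{−nk}` for all `n` by §2 and §1, so
`⟨σ₀σ_{ke₁}⟩^∅ ≤ R^{−k}`; let `R ↑ γ₂`.) The rate is Wu's exact one (`T > T_c`); the constant one is the gain over
`torusRowPairLimit_exp_decay_of_lt_criticalBetaTwo_holds`.
[cite: Wu1966, T > T_c asymptotics of D_n(φ_Onsager) (= DeiftItsKrasovsky2013 §5 eq. (64))]
[cite: FriedliVelenik2017, p. 181 (correlation length) with Thm. 3.20] -/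
theorem twoPointFree_axis_le_inv_onsagerGammaTwo_pow {β : ℝ} (hβ0 : 0 < β) (hβc : β < criticalBetaTwo)
    (k : ℕ) : twoPointFree 2 β ![(k : ℤ), 0] ≤ (onsagerGammaTwo β)⁻¹ ^ k := by
  set t := twoPointFree 2 β ![(k : ℤ), 0]
  have hγ₂1 : 1 < onsagerGammaTwo β := (one_lt_onsagerGammaTwo_iff hβ0).2 hβc
  have hγ₂0 : 0 < onsagerGammaTwo β := one_pos.trans hγ₂1
  -- for every admissible radius
  have hR : ∀ R : ℝ, 1 < R → R < onsagerGammaTwo β → t ≤ R⁻¹ ^ k := by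
    intro R hR1 hR2
    obtain ⟨K, hK⟩ := exists_norm_toeplitzDet_onsagerSymbol_le_pow hβ0 hβc hR1 hR2
    have hρ : 0 < R⁻¹ ^ k := pow_pos (inv_pos.2 (one_pos.trans hR1)) k
    refine le_of_forall_pow_le_mul_pow hρ (K := K) fun n => ?_
    calc t ^ n ≤ twoPointFree 2 β (n • ![(k : ℤ), 0]) := pow_le_twoPointFree_nsmul hβ0.le _ n
      _ = twoPointFree 2 β ![((n * k : ℕ) : ℤ), 0] := by rw [nsmul_axis_two]
      _ ≤ ‖toeplitzDet (circleCoeff (onsagerSymbol β)) (n * k)‖ :=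
          twoPointFree_axis_le_norm_toeplitzDet hβ0 hβc _
      _ ≤ K * R⁻¹ ^ (n * k) := hK _
      _ = K * (R⁻¹ ^ k) ^ n := by rw [mul_comm n k, pow_mul]
  -- let `R ↑ γ₂`
  have hcont : Tendsto (fun R : ℝ => R⁻¹ ^ k) (𝓝[<] onsagerGammaTwo β)
      (𝓝 ((onsagerGammaTwo β)⁻¹ ^ k)) :=
    (((continuousAt_inv₀ hγ₂0.ne').pow k).tendsto).mono_left nhdsWithin_le_nhds
  refine ge_of_tendsto hcont ?_
  filter_upwards [Ioo_mem_nhdsLT hγ₂1] with R hR'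
  exact hR R hR'.1 hR'.2

end Axis

/-! ## §4 All directions: `⟨σ₀σ_x⟩^∅_β ≤ (e^{2β} tanh β)^{‖x‖_∞}`; the closed forms of `γ₂⁻¹` -/

section SupNorm

open Finset Filter Topology Literature.Probability.Percolation

/-- `(k, 0) = k e₁` in `ℤ²` (`Pi.single` form used by the Messager–Miracle-Solé lemmas). [folklore] -/
private theorem single_zero_eq_axis_two (k : ℤ) :
    (Pi.single (⟨0, by norm_num⟩ : Fin 2) k : Site 2) = ![k, 0] := by
  ext i
  fin_cases i <;> simp

/-- **The planar Ising two-point function below Onsager's correlation length, all directions, constant one**: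
for the nearest-neighbour Ising model on `ℤ²`, `0 < β < β_c(2) = ½ log(1+√2)` and every `x ∈ ℤ²`,

  `⟨σ₀σ_x⟩^∅_β ≤ γ₂(β)^{−‖x‖_∞}`,  `γ₂(β)⁻¹ = e^{2β} tanh β < 1`.

(Messager–Miracle-Solé: `⟨σ₀σ_x⟩^∅ ≤ ⟨σ₀σ_{‖x‖_∞e₁}⟩^∅`, `twoPointFree_le_axis_of_mem_sphere'`; then §3.)
[cite: MessagerMiracleSoleJSP1977, main theorem (monotonicity of ⟨σ₀σ_x⟩ under reflections)]
[cite: Wu1966, T > T_c asymptotics of D_n(φ_Onsager) (= DeiftItsKrasovsky2013 §5 eq. (64))] -/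
theorem twoPointFree_two_le_inv_onsagerGammaTwo_pow_supNorm {β : ℝ} (hβ0 : 0 < β)
    (hβc : β < criticalBetaTwo) (x : Site 2) :
    twoPointFree 2 β x ≤ (onsagerGammaTwo β)⁻¹ ^ Site.supNorm x := by
  have h := twoPointFree_le_axis_of_mem_sphere' (d := 2) (y := x) hβ0.le (by norm_num)
    ((mem_sphere (d := 2)).2 rfl)
  rw [single_zero_eq_axis_two] at h
  exact h.trans (twoPointFree_axis_le_inv_onsagerGammaTwo_pow hβ0 hβc (Site.supNorm x))

/-- **`γ₂(β)⁻¹ = e^{2β} tanh β`** (`γ₂ = e^{−2β}/tanh β`, DIK eq. (22)). [cite: DeiftItsKrasovsky2013, §2, eq. (22)] -/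
theorem inv_onsagerGammaTwo_eq (β : ℝ) : (onsagerGammaTwo β)⁻¹ = Real.exp (2 * β) * Real.tanh β := by
  rw [onsagerGammaTwo, inv_div, show (-2 : ℝ) * β = -(2 * β) by ring, Real.exp_neg, div_inv_eq_mul]
  exact mul_comm _ _

/-- **`γ₂(β)⁻¹ = E(E−1)/(E+1)` with `E = e^{2β}`** (`tanh β = (e^{2β}−1)/(e^{2β}+1)`): one transcendental per
evaluation point, for rational enclosures. [cite: DeiftItsKrasovsky2013, §2, eq. (22)] -/
theorem inv_onsagerGammaTwo_eq_exp (β : ℝ) :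
    (onsagerGammaTwo β)⁻¹ =
      Real.exp (2 * β) * (Real.exp (2 * β) - 1) / (Real.exp (2 * β) + 1) := by
  rw [inv_onsagerGammaTwo_eq, Real.tanh_eq_sinh_div_cosh, Real.sinh_eq, Real.cosh_eq]
  have hE : Real.exp (2 * β) = Real.exp β * Real.exp β := by rw [← Real.exp_add]; ring_nf
  have hneg : Real.exp (-β) = (Real.exp β)⁻¹ := Real.exp_neg β
  rw [hE, hneg]
  field_simp

/-- `0 < γ₂(β)⁻¹` for `β > 0`. [cite: DeiftItsKrasovsky2013, §2, eq. (22)] -/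
theorem inv_onsagerGammaTwo_pos {β : ℝ} (hβ0 : 0 < β) : 0 < (onsagerGammaTwo β)⁻¹ :=
  inv_pos.2 (onsagerGammaTwo_pos hβ0)

/-- **`γ₂(β)⁻¹ < 1 ⟺ β < β_c(2)`** (for `β > 0`; DIK eq. (26)). [cite: DeiftItsKrasovsky2013, §2, eq. (26)] -/
theorem inv_onsagerGammaTwo_lt_one_iff {β : ℝ} (hβ0 : 0 < β) :
    (onsagerGammaTwo β)⁻¹ < 1 ↔ β < criticalBetaTwo := by
  rw [inv_lt_one_iff₀, one_lt_onsagerGammaTwo_iff hβ0]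
  constructor
  · rintro (h | h)
    · exact absurd h (not_le.2 (onsagerGammaTwo_pos hβ0))
    · exact h
  · exact fun h => Or.inr h

/-- **Monotonicity of `γ₂⁻¹ = e^{2β} tanh β` in `β`** on `[0, ∞)` (product of nonnegative nondecreasing factors):
the window functions built from it are monotone in the coupling. [cite: DeiftItsKrasovsky2013, §2, eq. (22)] -/
theorem inv_onsagerGammaTwo_mono {β β' : ℝ} (hβ0 : 0 ≤ β) (hββ' : β ≤ β') :
    (onsagerGammaTwo β)⁻¹ ≤ (onsagerGammaTwo β')⁻¹ := by
  rw [inv_onsagerGammaTwo_eq, inv_onsagerGammaTwo_eq]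
  have ht0 : 0 ≤ Real.tanh β := tanh_nonneg hβ0
  have ht : Real.tanh β ≤ Real.tanh β' := tanh_le_tanh hββ'
  exact mul_le_mul (Real.exp_le_exp.2 (by linarith)) ht ht0 (Real.exp_pos _).le

/-- **Exponential form**: `⟨σ₀σ_x⟩^∅_β ≤ exp(−m(β)‖x‖)` with `m(β) = log γ₂(β) = log coth β − 2β > 0`, the norm
on `ℤ²` being the sup norm — Onsager's inverse correlation length as an explicit decay rate with constant one,
for every `0 < β < β_c(2)`. [cite: Wu1966, T > T_c asymptotics of D_n(φ_Onsager) (= DeiftItsKrasovsky2013 §5 eq. (64))] -/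
theorem twoPointFree_two_le_exp_neg_log_onsagerGammaTwo_mul_norm {β : ℝ} (hβ0 : 0 < β)
    (hβc : β < criticalBetaTwo) (x : Site 2) :
    twoPointFree 2 β x ≤ Real.exp (-Real.log (onsagerGammaTwo β) * ‖x‖) := by
  have hγ₂0 : 0 < onsagerGammaTwo β := onsagerGammaTwo_pos hβ0
  have h := twoPointFree_two_le_inv_onsagerGammaTwo_pow_supNorm hβ0 hβc x
  rw [Site.norm_eq_supNorm, show -Real.log (onsagerGammaTwo β) * (Site.supNorm x : ℝ) =
      (Site.supNorm x : ℝ) * Real.log (onsagerGammaTwo β)⁻¹ by rw [Real.log_inv]; ring,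
    Real.exp_nat_mul, Real.exp_log (inv_pos.2 hγ₂0)]
  exact h

/-- **Positivity of the rate**: `0 < log γ₂(β)` for `0 < β < β_c(2)`. [cite: DeiftItsKrasovsky2013, §2, eq. (26)] -/
theorem log_onsagerGammaTwo_pos {β : ℝ} (hβ0 : 0 < β) (hβc : β < criticalBetaTwo) :
    0 < Real.log (onsagerGammaTwo β) :=
  Real.log_pos ((one_lt_onsagerGammaTwo_iff hβ0).2 hβc)

end SupNorm

end Literature.Probability.LatticeModels

end
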